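import Summits.Ventures.Crystal3D.Theorems.StickyWulffConstantNoReconstructionGainSymmetry
import Literature.Algebra.EuclideanLattices.FccBccLattices
import HarnessLib

/-!
# The cubic point group of `Λ₀` in the tree's frame: generators and their action on the cubic coordinates

HONEST FRAMING. Part of the venture `Summits/Ventures/Crystal3D` (cell `crystal3d-full`), helper
`--supports` the crux `NoReconstructionGain` (stmt-Ventures-19144, route
`route-Ventures-StickyWulffConstant`), line `adhesion`; companion of `…NoReconstructionGainSymmetry`
(bond mirrors and `−1` are lattice isometries of `Λ₀ = fccStacking 1 √(2/3)`) and groundwork for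
`…NoReconstructionGainChamber` (every normal has a lattice-symmetric copy in a fundamental triangle).

Content: the lattice isometries (`g` linear isometry with `g Λ₀ ⊆ Λ₀ ⊇ g⁻¹ Λ₀`) are closed under
composition and contain the identity, `−1` and the six bond mirrors orthogonal to
`u = (1,0,0)`, `v = (1/2, √3/2, 0)`, `t = (1/2, √3/6, √(2/3))`, `u − v`, `u − t`, `v − t`
(`bond_coords`, `bond_mem_and_norm`, `latticeIsometry_*`); and in the cubic coordinates
`A = ν₀ + (√3/3)ν₁ − √(2/3)ν₂`, `B = ν₀ − (√3/3)ν₁ + √(2/3)ν₂`, `C = (2√3/3)ν₁ + √(2/3)ν₂` of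
`…CubicFrame` these generators act by signed permutations (`cubic_actions`):
`r_u ↦ (−B, −A, C)`, `r_v ↦ (−C, B, −A)`, `r_t ↦ (A, −C, −B)`, `r_{u−v} ↦ (A, C, B)`,
`r_{u−t} ↦ (C, B, A)`, `r_{v−t} ↦ (B, A, C)`, `−1 ↦ (−A, −B, −C)` — the Coxeter presentation of
`O_h = W(B₃)` restricted to its subgroup generated inside the tree.  The cubic coordinates enter as
functions `A B C` constrained by their defining equations (no definitions are introduced).

WHAT THIS IS NOT: anything about packings; rung F-C1 not moved.
-/

noncomputable section

namespace Summit.Ventures.Crystal3D.Theorems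

open Summit.Ventures.Crystal3D Finset
open Literature.MathematicalPhysics.StatisticalMechanics (barlowPos barlowStacking fccStacking
  constHagg barlowPos_mem haggLabel_const barlowPos_apply_zero barlowPos_apply_one
  barlowPos_apply_two orderedContacts contactDeficiency)
open scoped InnerProductSpace

/-! ### 1. Lattice isometries: closure, generators -/

/-- Lattice isometries compose. -/
theorem latticeIsometry_trans {g₁ g₂ : EuclideanSpace ℝ (Fin 3) ≃ₗᵢ[ℝ] EuclideanSpace ℝ (Fin 3)}
    (h₁ : (∀ p ∈ fccStacking 1 (Real.sqrt (2 / 3)), g₁ p ∈ fccStacking 1 (Real.sqrt (2 / 3))) ∧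
      (∀ p ∈ fccStacking 1 (Real.sqrt (2 / 3)), g₁.symm p ∈ fccStacking 1 (Real.sqrt (2 / 3))))
    (h₂ : (∀ p ∈ fccStacking 1 (Real.sqrt (2 / 3)), g₂ p ∈ fccStacking 1 (Real.sqrt (2 / 3))) ∧
      (∀ p ∈ fccStacking 1 (Real.sqrt (2 / 3)), g₂.symm p ∈ fccStacking 1 (Real.sqrt (2 / 3)))) :
    (∀ p ∈ fccStacking 1 (Real.sqrt (2 / 3)), (g₁.trans g₂) p ∈ fccStacking 1 (Real.sqrt (2 / 3))) ∧
      (∀ p ∈ fccStacking 1 (Real.sqrt (2 / 3)),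
        (g₁.trans g₂).symm p ∈ fccStacking 1 (Real.sqrt (2 / 3))) := by
  refine ⟨fun p hp => ?_, fun p hp => ?_⟩
  · rw [LinearIsometryEquiv.trans_apply]; exact h₂.1 _ (h₁.1 p hp)
  · rw [LinearIsometryEquiv.symm_trans, LinearIsometryEquiv.trans_apply]
    exact h₁.2 _ (h₂.2 p hp)

/-- The bond mirror of a unit lattice vector is a lattice isometry (both directions). -/
theorem latticeIsometry_bondReflection {w : EuclideanSpace ℝ (Fin 3)}
    (hw : w ∈ fccStacking 1 (Real.sqrt (2 / 3))) (hw1 : ‖w‖ = 1) :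
    (∀ p ∈ fccStacking 1 (Real.sqrt (2 / 3)),
        (ℝ ∙ w)ᗮ.reflection p ∈ fccStacking 1 (Real.sqrt (2 / 3))) ∧
      (∀ p ∈ fccStacking 1 (Real.sqrt (2 / 3)),
        ((ℝ ∙ w)ᗮ.reflection).symm p ∈ fccStacking 1 (Real.sqrt (2 / 3))) := by
  refine ⟨fun p hp => bondReflection_mem_fcc hw hw1 hp, fun p hp => ?_⟩
  rw [bondReflection_symm]; exact bondReflection_mem_fcc hw hw1 hp

/-- The central inversion is a lattice isometry. -/
theorem latticeIsometry_neg :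
    (∀ p ∈ fccStacking 1 (Real.sqrt (2 / 3)),
        LinearIsometryEquiv.neg ℝ p ∈ fccStacking 1 (Real.sqrt (2 / 3))) ∧
      (∀ p ∈ fccStacking 1 (Real.sqrt (2 / 3)),
        (LinearIsometryEquiv.neg ℝ (E := EuclideanSpace ℝ (Fin 3))).symm p ∈
          fccStacking 1 (Real.sqrt (2 / 3))) :=
  ⟨fun _ hp => fcc_neg_mem hp, fun _ hp => fcc_neg_mem hp⟩

/-- The identity is a lattice isometry. -/
theorem latticeIsometry_refl :
    (∀ p ∈ fccStacking 1 (Real.sqrt (2 / 3)),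
        LinearIsometryEquiv.refl ℝ (EuclideanSpace ℝ (Fin 3)) p ∈ fccStacking 1 (Real.sqrt (2 / 3))) ∧
      (∀ p ∈ fccStacking 1 (Real.sqrt (2 / 3)),
        (LinearIsometryEquiv.refl ℝ (EuclideanSpace ℝ (Fin 3))).symm p ∈
          fccStacking 1 (Real.sqrt (2 / 3))) :=
  ⟨fun _ hp => hp, fun _ hp => hp⟩

/-- Coordinates of the three bonds `u = (0,1,0)`, `v = (0,0,1)`, `t = (1,0,0)` of the model frame:
`u = (1, 0, 0)`, `v = (1/2, √3/2, 0)`, `t = (1/2, √3/6, √(2/3))`. -/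
theorem bond_coords :
    (barlowPos 1 (Real.sqrt (2 / 3)) constHagg 0 1 0 0 = 1 ∧
      barlowPos 1 (Real.sqrt (2 / 3)) constHagg 0 1 0 1 = 0 ∧
      barlowPos 1 (Real.sqrt (2 / 3)) constHagg 0 1 0 2 = 0) ∧
    (barlowPos 1 (Real.sqrt (2 / 3)) constHagg 0 0 1 0 = 1 / 2 ∧
      barlowPos 1 (Real.sqrt (2 / 3)) constHagg 0 0 1 1 = Real.sqrt 3 / 2 ∧
      barlowPos 1 (Real.sqrt (2 / 3)) constHagg 0 0 1 2 = 0) ∧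
    (barlowPos 1 (Real.sqrt (2 / 3)) constHagg 1 0 0 0 = 1 / 2 ∧
      barlowPos 1 (Real.sqrt (2 / 3)) constHagg 1 0 0 1 = Real.sqrt 3 / 6 ∧
      barlowPos 1 (Real.sqrt (2 / 3)) constHagg 1 0 0 2 = Real.sqrt (2 / 3)) := by
  simp only [barlowPos_apply_zero, barlowPos_apply_one, barlowPos_apply_two, haggLabel_const]
  push_cast
  refine ⟨⟨?_, ?_, ?_⟩, ⟨?_, ?_, ?_⟩, ⟨?_, ?_, ?_⟩⟩ <;> ring

/-- The six bonds `u, v, t, u−v, u−t, v−t` are unit lattice vectors. -/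
theorem bond_mem_and_norm :
    (barlowPos 1 (Real.sqrt (2 / 3)) constHagg 0 1 0 ∈ fccStacking 1 (Real.sqrt (2 / 3)) ∧
      ‖barlowPos 1 (Real.sqrt (2 / 3)) constHagg 0 1 0‖ = 1) ∧
    (barlowPos 1 (Real.sqrt (2 / 3)) constHagg 0 0 1 ∈ fccStacking 1 (Real.sqrt (2 / 3)) ∧
      ‖barlowPos 1 (Real.sqrt (2 / 3)) constHagg 0 0 1‖ = 1) ∧
    (barlowPos 1 (Real.sqrt (2 / 3)) constHagg 1 0 0 ∈ fccStacking 1 (Real.sqrt (2 / 3)) ∧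
      ‖barlowPos 1 (Real.sqrt (2 / 3)) constHagg 1 0 0‖ = 1) ∧
    (barlowPos 1 (Real.sqrt (2 / 3)) constHagg 0 1 0 - barlowPos 1 (Real.sqrt (2 / 3)) constHagg 0 0 1 ∈
        fccStacking 1 (Real.sqrt (2 / 3)) ∧
      ‖barlowPos 1 (Real.sqrt (2 / 3)) constHagg 0 1 0 -
        barlowPos 1 (Real.sqrt (2 / 3)) constHagg 0 0 1‖ = 1) ∧
    (barlowPos 1 (Real.sqrt (2 / 3)) constHagg 0 1 0 - barlowPos 1 (Real.sqrt (2 / 3)) constHagg 1 0 0 ∈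
        fccStacking 1 (Real.sqrt (2 / 3)) ∧
      ‖barlowPos 1 (Real.sqrt (2 / 3)) constHagg 0 1 0 -
        barlowPos 1 (Real.sqrt (2 / 3)) constHagg 1 0 0‖ = 1) ∧
    (barlowPos 1 (Real.sqrt (2 / 3)) constHagg 0 0 1 - barlowPos 1 (Real.sqrt (2 / 3)) constHagg 1 0 0 ∈
        fccStacking 1 (Real.sqrt (2 / 3)) ∧
      ‖barlowPos 1 (Real.sqrt (2 / 3)) constHagg 0 0 1 -
        barlowPos 1 (Real.sqrt (2 / 3)) constHagg 1 0 0‖ = 1) := by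
  refine ⟨⟨barlowPos_mem _ _ _, norm_barlowPos_fcc_eq_one (by norm_num)⟩,
    ⟨barlowPos_mem _ _ _, norm_barlowPos_fcc_eq_one (by norm_num)⟩,
    ⟨barlowPos_mem _ _ _, norm_barlowPos_fcc_eq_one (by norm_num)⟩, ?_, ?_, ?_⟩ <;>
    rw [barlowPos_fcc_sub] <;>
    exact ⟨barlowPos_mem _ _ _, norm_barlowPos_fcc_eq_one (by norm_num)⟩

/-! ### 2. The generators act on the cubic coordinates by signed permutations -/

/-- A bond mirror acts on a linear functional `L` by `L (r_w x) = L x − 2⟪w,x⟫ L w`; here for the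
three cubic coordinates at once. -/
theorem cubic_reflection (A B C : EuclideanSpace ℝ (Fin 3) → ℝ)
    (hA : ∀ x, A x = x 0 + Real.sqrt 3 / 3 * x 1 - Real.sqrt (2 / 3) * x 2)
    (hB : ∀ x, B x = x 0 - Real.sqrt 3 / 3 * x 1 + Real.sqrt (2 / 3) * x 2)
    (hC : ∀ x, C x = 2 * Real.sqrt 3 / 3 * x 1 + Real.sqrt (2 / 3) * x 2)
    (w x : EuclideanSpace ℝ (Fin 3)) (hw : ‖w‖ = 1) :
    A ((ℝ ∙ w)ᗮ.reflection x) = A x - 2 * ⟪w, x⟫_ℝ * A w ∧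
      B ((ℝ ∙ w)ᗮ.reflection x) = B x - 2 * ⟪w, x⟫_ℝ * B w ∧
      C ((ℝ ∙ w)ᗮ.reflection x) = C x - 2 * ⟪w, x⟫_ℝ * C w := by
  have hc : ∀ l : Fin 3, ((ℝ ∙ w)ᗮ.reflection x) l = x l - 2 * ⟪w, x⟫_ℝ * w l := by
    intro l
    rw [bondReflection_apply w x hw]
    simp [mul_assoc]
  rw [hA, hA, hA, hB, hB, hB, hC, hC, hC, hc 0, hc 1, hc 2]
  refine ⟨by ring, by ring, by ring⟩

/-- **The actions.**  On `(A, B, C)`: `r_u ↦ (−B, −A, C)`, `r_v ↦ (−C, B, −A)`, `r_t ↦ (A, −C, −B)`,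
`r_{u−v} ↦ (A, C, B)`, `r_{u−t} ↦ (C, B, A)`, `r_{v−t} ↦ (B, A, C)`, `−1 ↦ (−A, −B, −C)`. -/
theorem cubic_actions (A B C : EuclideanSpace ℝ (Fin 3) → ℝ)
    (hA : ∀ x, A x = x 0 + Real.sqrt 3 / 3 * x 1 - Real.sqrt (2 / 3) * x 2)
    (hB : ∀ x, B x = x 0 - Real.sqrt 3 / 3 * x 1 + Real.sqrt (2 / 3) * x 2)
    (hC : ∀ x, C x = 2 * Real.sqrt 3 / 3 * x 1 + Real.sqrt (2 / 3) * x 2)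
    (x : EuclideanSpace ℝ (Fin 3)) :
    (A ((ℝ ∙ barlowPos 1 (Real.sqrt (2 / 3)) constHagg 0 1 0)ᗮ.reflection x) = -B x ∧
      B ((ℝ ∙ barlowPos 1 (Real.sqrt (2 / 3)) constHagg 0 1 0)ᗮ.reflection x) = -A x ∧
      C ((ℝ ∙ barlowPos 1 (Real.sqrt (2 / 3)) constHagg 0 1 0)ᗮ.reflection x) = C x) ∧
    (A ((ℝ ∙ barlowPos 1 (Real.sqrt (2 / 3)) constHagg 0 0 1)ᗮ.reflection x) = -C x ∧
      B ((ℝ ∙ barlowPos 1 (Real.sqrt (2 / 3)) constHagg 0 0 1)ᗮ.reflection x) = B x ∧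
      C ((ℝ ∙ barlowPos 1 (Real.sqrt (2 / 3)) constHagg 0 0 1)ᗮ.reflection x) = -A x) ∧
    (A ((ℝ ∙ barlowPos 1 (Real.sqrt (2 / 3)) constHagg 1 0 0)ᗮ.reflection x) = A x ∧
      B ((ℝ ∙ barlowPos 1 (Real.sqrt (2 / 3)) constHagg 1 0 0)ᗮ.reflection x) = -C x ∧
      C ((ℝ ∙ barlowPos 1 (Real.sqrt (2 / 3)) constHagg 1 0 0)ᗮ.reflection x) = -B x) ∧
    (A ((ℝ ∙ (barlowPos 1 (Real.sqrt (2 / 3)) constHagg 0 1 0 -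
          barlowPos 1 (Real.sqrt (2 / 3)) constHagg 0 0 1))ᗮ.reflection x) = A x ∧
      B ((ℝ ∙ (barlowPos 1 (Real.sqrt (2 / 3)) constHagg 0 1 0 -
          barlowPos 1 (Real.sqrt (2 / 3)) constHagg 0 0 1))ᗮ.reflection x) = C x ∧
      C ((ℝ ∙ (barlowPos 1 (Real.sqrt (2 / 3)) constHagg 0 1 0 -
          barlowPos 1 (Real.sqrt (2 / 3)) constHagg 0 0 1))ᗮ.reflection x) = B x) ∧
    (A ((ℝ ∙ (barlowPos 1 (Real.sqrt (2 / 3)) constHagg 0 1 0 -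
          barlowPos 1 (Real.sqrt (2 / 3)) constHagg 1 0 0))ᗮ.reflection x) = C x ∧
      B ((ℝ ∙ (barlowPos 1 (Real.sqrt (2 / 3)) constHagg 0 1 0 -
          barlowPos 1 (Real.sqrt (2 / 3)) constHagg 1 0 0))ᗮ.reflection x) = B x ∧
      C ((ℝ ∙ (barlowPos 1 (Real.sqrt (2 / 3)) constHagg 0 1 0 -
          barlowPos 1 (Real.sqrt (2 / 3)) constHagg 1 0 0))ᗮ.reflection x) = A x) ∧
    (A ((ℝ ∙ (barlowPos 1 (Real.sqrt (2 / 3)) constHagg 0 0 1 -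
          barlowPos 1 (Real.sqrt (2 / 3)) constHagg 1 0 0))ᗮ.reflection x) = B x ∧
      B ((ℝ ∙ (barlowPos 1 (Real.sqrt (2 / 3)) constHagg 0 0 1 -
          barlowPos 1 (Real.sqrt (2 / 3)) constHagg 1 0 0))ᗮ.reflection x) = A x ∧
      C ((ℝ ∙ (barlowPos 1 (Real.sqrt (2 / 3)) constHagg 0 0 1 -
          barlowPos 1 (Real.sqrt (2 / 3)) constHagg 1 0 0))ᗮ.reflection x) = C x) ∧
    (A (LinearIsometryEquiv.neg ℝ x) = -A x ∧ B (LinearIsometryEquiv.neg ℝ x) = -B x ∧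
      C (LinearIsometryEquiv.neg ℝ x) = -C x) := by
  have h3 : Real.sqrt 3 ^ 2 = 3 := Real.sq_sqrt (by norm_num)
  have h23 : Real.sqrt (2 / 3) ^ 2 = 2 / 3 := Real.sq_sqrt (by norm_num)
  obtain ⟨⟨hu0, hu1, hu2⟩, ⟨hv0, hv1, hv2⟩, ⟨ht0, ht1, ht2⟩⟩ := bond_coords
  obtain ⟨⟨-, hun⟩, ⟨-, hvn⟩, ⟨-, htn⟩, ⟨-, huvn⟩, ⟨-, hutn⟩, ⟨-, hvtn⟩⟩ := bond_mem_and_norm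
  set u : EuclideanSpace ℝ (Fin 3) := barlowPos 1 (Real.sqrt (2 / 3)) constHagg 0 1 0 with hu
  set v : EuclideanSpace ℝ (Fin 3) := barlowPos 1 (Real.sqrt (2 / 3)) constHagg 0 0 1 with hv
  set t : EuclideanSpace ℝ (Fin 3) := barlowPos 1 (Real.sqrt (2 / 3)) constHagg 1 0 0 with ht
  -- values of the cubic coordinates at the bonds
  have hAu : A u = 1 := by rw [hA, hu0, hu1, hu2]; ring
  have hBu : B u = 1 := by rw [hB, hu0, hu1, hu2]; ring
  have hCu : C u = 0 := by rw [hC, hu1, hu2]; ring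
  have hAv : A v = 1 := by rw [hA, hv0, hv1, hv2]; linear_combination (1 / 6 : ℝ) * h3
  have hBv : B v = 0 := by rw [hB, hv0, hv1, hv2]; linear_combination (-1 / 6 : ℝ) * h3
  have hCv : C v = 1 := by rw [hC, hv1, hv2]; linear_combination (1 / 3 : ℝ) * h3
  have hAt : A t = 0 := by rw [hA, ht0, ht1, ht2]; linear_combination (1 / 18 : ℝ) * h3 - h23
  have hBt : B t = 1 := by rw [hB, ht0, ht1, ht2]; linear_combination (-1 / 18 : ℝ) * h3 + h23
  have hCt : C t = 1 := by rw [hC, ht1, ht2]; linear_combination (1 / 9 : ℝ) * h3 + h23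
  have hlin : ∀ (F : EuclideanSpace ℝ (Fin 3) → ℝ) (a b c : ℝ),
      (∀ y, F y = a * y 0 + b * y 1 + c * y 2) → ∀ y z, F (y - z) = F y - F z := by
    intro F a b c hF y z
    rw [hF, hF, hF]; simp only [PiLp.sub_apply]; ring
  have hAl : ∀ y z, A (y - z) = A y - A z :=
    hlin A 1 (Real.sqrt 3 / 3) (-Real.sqrt (2 / 3)) (fun y => by rw [hA]; ring)
  have hBl : ∀ y z, B (y - z) = B y - B z :=
    hlin B 1 (-(Real.sqrt 3 / 3)) (Real.sqrt (2 / 3)) (fun y => by rw [hB]; ring)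
  have hCl : ∀ y z, C (y - z) = C y - C z :=
    hlin C 0 (2 * Real.sqrt 3 / 3) (Real.sqrt (2 / 3)) (fun y => by rw [hC]; ring)
  -- inner products with the bonds in terms of the cubic coordinates
  have hiu : 2 * ⟪u, x⟫_ℝ = A x + B x := by
    rw [Literature.Algebra.EuclideanLattices.inner_fin_three, hu0, hu1, hu2, hA, hB]; ring
  have hiv : 2 * ⟪v, x⟫_ℝ = A x + C x := by
    rw [Literature.Algebra.EuclideanLattices.inner_fin_three, hv0, hv1, hv2, hA, hC]; ring
  have hit : 2 * ⟪t, x⟫_ℝ = B x + C x := by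
    rw [Literature.Algebra.EuclideanLattices.inner_fin_three, ht0, ht1, ht2, hB, hC]; ring
  have hiuv : 2 * ⟪u - v, x⟫_ℝ = B x - C x := by rw [inner_sub_left]; linarith
  have hiut : 2 * ⟪u - t, x⟫_ℝ = A x - C x := by rw [inner_sub_left]; linarith
  have hivt : 2 * ⟪v - t, x⟫_ℝ = A x - B x := by rw [inner_sub_left]; linarith
  have key : ∀ w : EuclideanSpace ℝ (Fin 3), ‖w‖ = 1 → ∀ s : ℝ, 2 * ⟪w, x⟫_ℝ = s →
      A ((ℝ ∙ w)ᗮ.reflection x) = A x - s * A w ∧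
        B ((ℝ ∙ w)ᗮ.reflection x) = B x - s * B w ∧
        C ((ℝ ∙ w)ᗮ.reflection x) = C x - s * C w := by
    intro w hw s hs
    obtain ⟨e1, e2, e3⟩ := cubic_reflection A B C hA hB hC w x hw
    rw [e1, e2, e3, ← hs]
    exact ⟨by ring, by ring, by ring⟩
  refine ⟨?_, ?_, ?_, ?_, ?_, ?_, ?_⟩
  · obtain ⟨e1, e2, e3⟩ := key u hun _ hiu
    rw [e1, e2, e3, hAu, hBu, hCu]
    exact ⟨by ring, by ring, by ring⟩
  · obtain ⟨e1, e2, e3⟩ := key v hvn _ hiv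
    rw [e1, e2, e3, hAv, hBv, hCv]
    exact ⟨by ring, by ring, by ring⟩
  · obtain ⟨e1, e2, e3⟩ := key t htn _ hit
    rw [e1, e2, e3, hAt, hBt, hCt]
    exact ⟨by ring, by ring, by ring⟩
  · obtain ⟨e1, e2, e3⟩ := key (u - v) huvn _ hiuv
    rw [e1, e2, e3, hAl, hBl, hCl, hAu, hBu, hCu, hAv, hBv, hCv]
    exact ⟨by ring, by ring, by ring⟩
  · obtain ⟨e1, e2, e3⟩ := key (u - t) hutn _ hiut
    rw [e1, e2, e3, hAl, hBl, hCl, hAu, hBu, hCu, hAt, hBt, hCt]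
    exact ⟨by ring, by ring, by ring⟩
  · obtain ⟨e1, e2, e3⟩ := key (v - t) hvtn _ hivt
    rw [e1, e2, e3, hAl, hBl, hCl, hAv, hBv, hCv, hAt, hBt, hCt]
    exact ⟨by ring, by ring, by ring⟩
  · rw [hA, hB, hC, hA x, hB x, hC x]
    simp only [LinearIsometryEquiv.coe_neg, PiLp.neg_apply]
    exact ⟨by ring, by ring, by ring⟩

end Summit.Ventures.Crystal3D.Theorems
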